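import Summits.NavierStokesRegularity.NavierStokesRegularity.Theorems.RootDecompLiouvilleHorizonLadderTop
import Summits.NavierStokesRegularity.NavierStokesRegularity.Theses.RootDecompReynoldsHorizon
import HarnessLib

/-!
# Route `RootDecompReynoldsHorizon` (N13) meets `RootDecompLiouvilleHorizon` (N22): the REYNOLDS FLOOR
# `NoLowReynoldsBlowup` (stmt-NavierStokesRegularity-28921) and the ENERGY CEILING (stmt-28922) — PROVED;
# V `NoViscousTypeII` (stmt-28919) ⟸ Q♭ ⟸ (L); E♯ (stmt-32033) ⟸ E (stmt-28920); N13's `Assembly` (stmt-28925)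

N13 cuts the B1 blocker by the CORE REYNOLDS NUMBER of the fast points: Clay (A) ⟸ V (no viscous Type II:
fast points `‖u‖ ≥ 1` that stay `R`-viscous, `‖u(t,x)‖² ≤ R·ν·‖∇u(t)(y)‖`, for ONE `R` eventually) ∧ E (no
Eulerian Type II, the declared residual) ∧ P1. N22's horizon machinery (landed `RootDecompLiouvilleHorizonKills`:
the record selection `frequently_nearRecord`, the restart `not_frequently_viscous_of_rung`; and the top rung
`SmoothingRung`, `RootDecompLiouvilleHorizonLadderTop.smoothingRung_proof`) decides N13's theorem-grade items and
places its cruxes: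

* §1 RECORDS ARE FAST POINTS: an eventually-`R`-viscous blow-up is `R`-viscous along the record subsequence
  (`frequently_recordViscous_of_eventually`), so every rung `ε` of the horizon with `4Rε < 1` forbids it
  (`not_eventuallyViscous_of_rung`).
* §2 THE REYNOLDS FLOOR `noLowReynoldsBlowup_proof : NoLowReynoldsBlowup` (item 28921, V's base rung, EXPECTED
  THEOREM): `ε = 1/(8ε₀)` with `ε₀` the constant of the PROVED top rung `SmoothingRung` (KNSS smoothing, k = 1).
* §3 V IS BELOW THE HORIZON: `noViscousTypeII_of_blowupHorizon : BlowupHorizon → NoViscousTypeII` (all rungs kill all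
  `R`, tree `not_recordViscous_of_blowupHorizon`), hence `noViscousTypeII_of_typeIliouvilleL : (L) → V`.
* §4 THE RESIDUALS COMPARE: `noRecordEulerianTypeII_of_noEulerianTypeII : E → E♯` (N22's residual is weaker-or-equal
  than N13's), and the MERGE `navierStokesRegularity_of_typeIliouvilleL_of_noEulerianTypeII : (L) → E → Clay (A)`
  (N13 without P1 and with V discharged, through N22's deciding theorem).
* §5 N13's `Assembly` (item 28925) is its deciding theorem `closes` verbatim.
* §6 THE ENERGY CEILING `energyCeiling_proof : EnergyCeiling` (item 28922; elementary: mean value on the ball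
  `B(x, ‖f x‖/2G)` + `|B_ℓ| = ℓ³|B₁|` + `∫|f|² ≤ E` give `‖f x‖⁵|B₁| ≤ 32·E·G³`; port of the lens kernel 5a of
  decomp-ns lens 5 gen 5, `ReynoldsHorizon.lean`).

Def-free; axioms ⊆ {propext, Classical.choice, Quot.sound}.
Sources: [KochNadirashviliSereginSverak2009] arXiv:0709.3599 §4 (4.10), §6; Leray 1934 §20; Bradshaw–Farhat–Grujić
arXiv:1709.02970 (the Reynolds-number reading). Lens provenance: decomp-ns lens 5, gen 22 (HOME/decomp-ns-lens-5/NODE-g22.md §4d).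
-/

set_option linter.dupNamespace false

noncomputable section

open MeasureTheory Set Function Filter TopologicalSpace Metric
open scoped Topology ContDiff

namespace Summit.NavierStokesRegularity.NavierStokesRegularity.Theorems.RootDecompReynoldsHorizonFloor

open Literature.Analysis Literature.Analysis.FluidPDE
open Summit.NavierStokesRegularity.NavierStokesRegularity.Theorems
open Summit.NavierStokesRegularity.NavierStokesRegularity.Theses.RootDecompLiouvilleHorizon
  (BlowupHorizon ClayHorizon SmoothingRung TypeIliouvilleL NoRecordEulerianTypeII)
open Summit.NavierStokesRegularity.NavierStokesRegularity.Theses.RootDecompReynoldsHorizon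
  (NoViscousTypeII NoEulerianTypeII NoTypeIBlowup NoLowReynoldsBlowup EnergyCeiling)

/-! ### §1 Records are fast points -/

section Frame

variable {ν T : ℝ} {u : ℝ → EuclideanSpace ℝ (Fin 3) → EuclideanSpace ℝ (Fin 3)}
  {p : ℝ → EuclideanSpace ℝ (Fin 3) → ℝ}

/-- An eventually-`R`-viscous blow-up (N13's hypothesis: eventually EVERY fast point has an `R`-viscous gradient
witness) is `R`-viscous along the record subsequence of the frame (N22's hypothesis), because near-record fast
points occur at times arbitrarily close to `T` (tree `frequently_nearRecord`). [cite: KochNadirashviliSereginSverak2009, §6 (arXiv:0709.3599 p. 11)] -/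
theorem frequently_recordViscous_of_eventually (hν : 0 < ν) (hT : 0 < T)
    (hmax : IsMaximalSmoothSolution ν 0 u p T) (hLH : IsLerayHopfOn T ν 0 (u 0) u)
    (hdec : HasRapidSpatialDecay (u 0)) {R : ℝ}
    (hev : ∀ᶠ t in 𝓝[<] T, ∀ x : EuclideanSpace ℝ (Fin 3), 1 ≤ ‖u t x‖ →
      ∃ y : EuclideanSpace ℝ (Fin 3), ‖u t x‖ ^ 2 ≤ R * ν * ‖fderiv ℝ (u t) y‖) :
    ∃ᶠ t in 𝓝[<] T, ∃ x : EuclideanSpace ℝ (Fin 3), 1 ≤ ‖u t x‖ ∧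
      (∀ s ∈ Set.Ioc 0 t, ∀ y : EuclideanSpace ℝ (Fin 3), ‖u s y‖ ≤ 2 * ‖u t x‖) ∧
      ∃ y : EuclideanSpace ℝ (Fin 3), ‖u t x‖ ^ 2 ≤ R * ν * ‖fderiv ℝ (u t) y‖ :=
  ((RootDecompLiouvilleHorizonKills.frequently_nearRecord hν hT hmax hLH hdec).and_eventually hev).mono
    fun _ ⟨⟨x, hx1, hrec⟩, hvis⟩ => ⟨x, hx1, hrec, hvis x hx1⟩

/-- RESTART, eventual form: under rung `ε` of the blow-up horizon (maximal frame) no blow-up is eventually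
`R`-viscous with `4Rε < 1` (tree `not_frequently_viscous_of_rung` on the record subsequence). [cite: KochNadirashviliSereginSverak2009, §6 (arXiv:0709.3599 p. 13)] -/
theorem not_eventuallyViscous_of_rung {ε : ℝ}
    (hH : ∃ S : ℝ, 0 < S ∧ ∀ (ν T : ℝ), 0 < ν → 0 < T →
      ∀ (u : ℝ → EuclideanSpace ℝ (Fin 3) → EuclideanSpace ℝ (Fin 3)) (p : ℝ → EuclideanSpace ℝ (Fin 3) → ℝ),
      Literature.Analysis.FluidPDE.IsMaximalSmoothSolution ν 0 u p T →
      Literature.Analysis.FluidPDE.IsLerayHopfOn T ν 0 (u 0) u →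
      Literature.Analysis.FluidPDE.HasRapidSpatialDecay (u 0) →
      ∀ t ∈ Set.Ioo 0 T, ∀ M : ℝ, S * ν ≤ M ^ 2 * t →
      (∀ s ∈ Set.Ioc 0 t, ∀ y : EuclideanSpace ℝ (Fin 3), ‖u s y‖ ≤ M) →
      ∀ y : EuclideanSpace ℝ (Fin 3), ν * ‖fderiv ℝ (u t) y‖ ≤ ε * M ^ 2)
    (hν : 0 < ν) (hT : 0 < T) (hmax : IsMaximalSmoothSolution ν 0 u p T)
    (hLH : IsLerayHopfOn T ν 0 (u 0) u) (hdec : HasRapidSpatialDecay (u 0)) {R : ℝ}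
    (hRε : 4 * R * ε < 1) :
    ¬ ∀ᶠ t in 𝓝[<] T, ∀ x : EuclideanSpace ℝ (Fin 3), 1 ≤ ‖u t x‖ →
      ∃ y : EuclideanSpace ℝ (Fin 3), ‖u t x‖ ^ 2 ≤ R * ν * ‖fderiv ℝ (u t) y‖ :=
  fun hev => RootDecompLiouvilleHorizonKills.not_frequently_viscous_of_rung hH hν hT hmax hLH hdec hRε
    (frequently_recordViscous_of_eventually hν hT hmax hLH hdec hev)

end Frame

/-! ### §2 The Reynolds floor -/

/-- The PROVED top rung `SmoothingRung` in the maximal frame. [cite: KochNadirashviliSereginSverak2009, §4 (4.10) (arXiv:0709.3599 p. 8)] -/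
theorem smoothingRung_maximal :
    ∃ ε₀ : ℝ, 0 < ε₀ ∧ ∃ S : ℝ, 0 < S ∧ ∀ (ν T : ℝ), 0 < ν → 0 < T →
      ∀ (u : ℝ → EuclideanSpace ℝ (Fin 3) → EuclideanSpace ℝ (Fin 3)) (p : ℝ → EuclideanSpace ℝ (Fin 3) → ℝ),
      Literature.Analysis.FluidPDE.IsMaximalSmoothSolution ν 0 u p T →
      Literature.Analysis.FluidPDE.IsLerayHopfOn T ν 0 (u 0) u →
      Literature.Analysis.FluidPDE.HasRapidSpatialDecay (u 0) →
      ∀ t ∈ Set.Ioo 0 T, ∀ M : ℝ, S * ν ≤ M ^ 2 * t →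
      (∀ s ∈ Set.Ioc 0 t, ∀ y : EuclideanSpace ℝ (Fin 3), ‖u s y‖ ≤ M) →
      ∀ y : EuclideanSpace ℝ (Fin 3), ν * ‖fderiv ℝ (u t) y‖ ≤ ε₀ * M ^ 2 := by
  obtain ⟨ε₀, hε₀, S, hS, h⟩ := RootDecompLiouvilleHorizonLadderTop.smoothingRung_proof
  exact ⟨ε₀, hε₀, S, hS, fun ν T hν hT u p hmax => h ν T hν hT u p hmax.1⟩

/-- **THE REYNOLDS FLOOR `NoLowReynoldsBlowup` (item stmt-NavierStokesRegularity-28921) — PROVED**, with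
`ε = 1/(8ε₀)`: a first blow-up whose fast points stay `ε`-viscous at all late times does not exist (so it is
Type I vacuously) — the restart under the proved top rung. [cite: KochNadirashviliSereginSverak2009, §4 (4.10) and §6 (arXiv:0709.3599 pp. 8, 13)] -/
theorem noLowReynoldsBlowup_proof : NoLowReynoldsBlowup := by
  obtain ⟨ε₀, hε₀, hrung⟩ := smoothingRung_maximal
  refine ⟨1 / (8 * ε₀), by positivity, ?_⟩
  intro ν T hν hT u p hmax hLH hdec hev
  have h8 : 0 < 8 * ε₀ := by positivity
  have hRε : 4 * (1 / (8 * ε₀)) * ε₀ < 1 := by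
    rw [mul_one_div, div_mul_eq_mul_div, div_lt_one h8]
    linarith
  exact absurd hev (not_eventuallyViscous_of_rung hrung hν hT hmax hLH hdec hRε)

/-! ### §3 V is below the horizon -/

/-- **V ⟸ Q♭**: under the blow-up horizon no blow-up is eventually `R`-viscous, for any `R` (tree
`not_recordViscous_of_blowupHorizon` on the record subsequence), so V holds (vacuously). [cite: KochNadirashviliSereginSverak2009, §6 (arXiv:0709.3599 p. 13)] -/
theorem noViscousTypeII_of_blowupHorizon (hQ : BlowupHorizon) : NoViscousTypeII := by
  intro ν T hν hT u p hmax hLH hdec hb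
  obtain ⟨R, hev⟩ := hb
  exact absurd ⟨R, frequently_recordViscous_of_eventually hν hT hmax hLH hdec hev⟩
    (RootDecompLiouvilleHorizonKills.not_recordViscous_of_blowupHorizon hQ hν hT hmax hLH hdec)

/-- **V ⟸ Q** (the Clay-class horizon). [cite: KochNadirashviliSereginSverak2009, §6 (arXiv:0709.3599 p. 13)] -/
theorem noViscousTypeII_of_clayHorizon (hQ : ClayHorizon) : NoViscousTypeII :=
  noViscousTypeII_of_blowupHorizon (RootDecompLiouvilleHorizonLadderTop.blowupHorizon_of_clayHorizon hQ)

/-- **V ⟸ (L)** (the KNSS Liouville conjecture; CPT and the top rung are theorems). [cite: KochNadirashviliSereginSverak2009, §1 (arXiv:0709.3599 p. 2)] -/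
theorem noViscousTypeII_of_typeIliouvilleL (hL : TypeIliouvilleL) : NoViscousTypeII :=
  noViscousTypeII_of_blowupHorizon (RootDecompLiouvilleHorizonLadderTop.blowupHorizon_of_typeIliouvilleL hL)

/-! ### §4 The residuals compare; the merge -/

/-- **E ⟹ E♯**: N22's residual (no record-Eulerian Type II) is weaker-or-equal than N13's residual E (no Eulerian
Type II): a record-Eulerian blow-up is Eulerian. [folklore] -/
theorem noRecordEulerianTypeII_of_noEulerianTypeII (hE : NoEulerianTypeII) : NoRecordEulerianTypeII := by
  intro ν T hν hT u p hmax hLH hdec hnot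
  refine hE ν T hν hT u p hmax hLH hdec ?_
  rintro ⟨R, hev⟩
  exact hnot ⟨R, frequently_recordViscous_of_eventually hν hT hmax hLH hdec hev⟩

/-- **THE MERGE `(L) ∧ E ⟹ Clay (A)`**: under the Liouville conjecture N13's residual E alone closes the summit,
through N22's deciding theorem (Q♭ from (L), G, K1, K2 from the kernel, E♯ from E). [cite: KochNadirashviliSereginSverak2009, §1 and §6 (arXiv:0709.3599 pp. 2, 13)] -/
theorem navierStokesRegularity_of_typeIliouvilleL_of_noEulerianTypeII (hL : TypeIliouvilleL)
    (hE : NoEulerianTypeII) : NavierStokesRegularity :=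
  Theses.RootDecompLiouvilleHorizon.closes (RootDecompLiouvilleHorizonLadderTop.blowupHorizon_of_typeIliouvilleL hL)
    RootDecompLiouvilleHorizonTypeIGradientFloor.typeIGradientFloor_proof
    (noRecordEulerianTypeII_of_noEulerianTypeII hE)
    RootDecompLiouvilleHorizonKills.horizonRecordKill_proof
    RootDecompLiouvilleHorizonKills.horizonTypeIKill_proof

/-- **`Q♭ ∧ E ⟹ Clay (A)`** (the same with the blow-up horizon in place of (L)). [cite: KochNadirashviliSereginSverak2009, §6 (arXiv:0709.3599 p. 13)] -/
theorem navierStokesRegularity_of_blowupHorizon_of_noEulerianTypeII (hQ : BlowupHorizon)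
    (hE : NoEulerianTypeII) : NavierStokesRegularity :=
  Theses.RootDecompLiouvilleHorizon.closes hQ
    RootDecompLiouvilleHorizonTypeIGradientFloor.typeIGradientFloor_proof
    (noRecordEulerianTypeII_of_noEulerianTypeII hE)
    RootDecompLiouvilleHorizonKills.horizonRecordKill_proof
    RootDecompLiouvilleHorizonKills.horizonTypeIKill_proof

/-! ### §5 N13's Assembly -/

/-- **N13's `Assembly` (item stmt-NavierStokesRegularity-28925) — PROVED**: it is the route's deciding theorem
`closes` verbatim. [folklore] -/
theorem rootDecompReynoldsHorizon_assembly_proof : Theses.RootDecompReynoldsHorizon.Assembly :=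
  fun hV hE hI => Theses.RootDecompReynoldsHorizon.closes hV hE hI

/-! ### §6 The energy ceiling -/

/-- `|B(x, ℓ)| = ℓ³ |B₁|` in `ℝ³`. [folklore] -/
theorem volume_ball_eq (x : EuclideanSpace ℝ (Fin 3)) {ℓ : ℝ} (hℓ : 0 ≤ ℓ) :
    volume (ball x ℓ) = ENNReal.ofReal (ℓ ^ 3 * (volume (ball (0 : EuclideanSpace ℝ (Fin 3)) 1)).toReal) := by
  rw [Measure.addHaar_ball volume x hℓ, finrank_euclideanSpace_fin,
    ENNReal.ofReal_mul (pow_nonneg hℓ 3), ENNReal.ofReal_toReal measure_ball_lt_top.ne]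

/-- CORE ESTIMATE (mean value + ball volume + energy): if `‖∇f‖ ≤ G` everywhere and `∫|f|² ≤ E`, then
`‖f x‖⁵ · |B₁| ≤ 32 · E · G³` at every point. [folklore] -/
theorem pow_five_le_of_fderiv_le {f : EuclideanSpace ℝ (Fin 3) → EuclideanSpace ℝ (Fin 3)}
    (hf : Differentiable ℝ f) {G E : ℝ} (hG : 0 < G)
    (hbound : ∀ y, ‖fderiv ℝ f y‖ ≤ G) (hE : 0 ≤ E) (hen : ∫⁻ z, ‖f z‖ₑ ^ 2 ≤ ENNReal.ofReal E)
    (x : EuclideanSpace ℝ (Fin 3)) :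
    ‖f x‖ ^ 5 * (volume (ball (0 : EuclideanSpace ℝ (Fin 3)) 1)).toReal ≤ 32 * E * G ^ 3 := by
  rcases (norm_nonneg (f x)).eq_or_lt with h0 | hapos
  · rw [← h0]; simp only [ne_eq, OfNat.ofNat_ne_zero, not_false_eq_true, zero_pow, zero_mul]
    positivity
  set a := ‖f x‖ with ha
  set ℓ := a / (2 * G) with hℓ
  have hℓpos : 0 < ℓ := div_pos hapos (by positivity)
  have hlow : ∀ z ∈ ball x ℓ, a / 2 ≤ ‖f z‖ := by
    intro z hz
    have hmv : ‖f z - f x‖ ≤ G * ‖z - x‖ :=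
      convex_univ.norm_image_sub_le_of_norm_fderiv_le (fun y _ => hf y) (fun y _ => hbound y)
        (mem_univ x) (mem_univ z)
    have hzx : ‖z - x‖ < ℓ := by rwa [mem_ball_iff_norm] at hz
    have h1 : ‖f z - f x‖ ≤ a / 2 := by
      calc ‖f z - f x‖ ≤ G * ‖z - x‖ := hmv
        _ ≤ G * ℓ := by gcongr
        _ = a / 2 := by rw [hℓ]; field_simp
    have h2 : ‖f x‖ - ‖f z‖ ≤ ‖f x - f z‖ := norm_sub_norm_le _ _
    rw [norm_sub_rev] at h2
    linarith
  have hpt : ∀ z ∈ ball x ℓ, ENNReal.ofReal ((a / 2) ^ 2) ≤ ‖f z‖ₑ ^ 2 := by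
    intro z hz
    rw [← ofReal_norm, ← ENNReal.ofReal_pow (norm_nonneg _)]
    exact ENNReal.ofReal_le_ofReal (pow_le_pow_left₀ (by positivity) (hlow z hz) 2)
  have hint : ENNReal.ofReal ((a / 2) ^ 2) * volume (ball x ℓ) ≤ ∫⁻ z, ‖f z‖ₑ ^ 2 := by
    calc ENNReal.ofReal ((a / 2) ^ 2) * volume (ball x ℓ)
        = ∫⁻ _ in ball x ℓ, ENNReal.ofReal ((a / 2) ^ 2) := (setLIntegral_const _ _).symm
      _ ≤ ∫⁻ z in ball x ℓ, ‖f z‖ₑ ^ 2 := setLIntegral_mono' measurableSet_ball hpt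
      _ ≤ ∫⁻ z, ‖f z‖ₑ ^ 2 := setLIntegral_le_lintegral _ _
  rw [volume_ball_eq x hℓpos.le, ← ENNReal.ofReal_mul (sq_nonneg _)] at hint
  have hreal : (a / 2) ^ 2 * (ℓ ^ 3 * (volume (ball (0 : EuclideanSpace ℝ (Fin 3)) 1)).toReal) ≤ E :=
    (ENNReal.ofReal_le_ofReal_iff hE).1 (hint.trans hen)
  have hid : (a / 2) ^ 2 * (ℓ ^ 3 * (volume (ball (0 : EuclideanSpace ℝ (Fin 3)) 1)).toReal) =
      a ^ 5 * (volume (ball (0 : EuclideanSpace ℝ (Fin 3)) 1)).toReal / (32 * G ^ 3) := by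
    rw [hℓ]; field_simp; ring
  rw [hid, div_le_iff₀ (by positivity)] at hreal
  linarith

/-- **THE ENERGY CEILING `EnergyCeiling` (item stmt-NavierStokesRegularity-28922) — PROVED**, with
`c = (256/|B₁|)^{1/3}`: every differentiable `f : ℝ³ → ℝ³` with `∫|f|² ≤ E` has, at every fast point `x`
(`‖f x‖ ≥ 1`), a gradient witness `y` with `‖f x‖² ≤ c·E^{1/3}·‖∇f(y)‖·‖f x‖^{1/3}` (port of the lens kernel
`energyCeiling`, decomp-ns lens 5 gen 5). [folklore] -/
theorem energyCeiling_proof : EnergyCeiling := by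
  obtain ⟨V, hVdef⟩ : ∃ V : ℝ, (volume (ball (0 : EuclideanSpace ℝ (Fin 3)) 1)).toReal = V := ⟨_, rfl⟩
  have hv : 0 < V :=
    hVdef ▸ ENNReal.toReal_pos (measure_ball_pos volume (0 : EuclideanSpace ℝ (Fin 3)) one_pos).ne'
      measure_ball_lt_top.ne
  set c : ℝ := (256 / V) ^ (1 / 3 : ℝ) with hc
  have hcpos : 0 < c := Real.rpow_pos_of_pos (div_pos (by norm_num) hv) _
  refine ⟨c, hcpos, ?_⟩
  intro f E hf hE hen x hx
  set a := ‖f x‖ with ha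
  have hapos : 0 < a := lt_of_lt_of_le one_pos hx
  have h5 : 1 ≤ a ^ 5 := one_le_pow₀ hx
  have hthird : (1 / 3 : ℝ) = ((3 : ℕ) : ℝ)⁻¹ := by norm_num
  -- Reduction: it suffices to find `y` with `a⁵ ≤ (c E^{1/3} ‖∇f(y)‖)³`.
  suffices key : ∃ y, a ^ 5 ≤ (c * E ^ (1 / 3 : ℝ) * ‖fderiv ℝ f y‖) ^ 3 by
    obtain ⟨y, hy⟩ := key
    refine ⟨y, ?_⟩
    set K := c * E ^ (1 / 3 : ℝ) * ‖fderiv ℝ f y‖ with hK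
    have hK0 : 0 ≤ K := by positivity
    have h53 : a ^ (5 / 3 : ℝ) ≤ K := by
      have h1 : (a ^ 5) ^ (1 / 3 : ℝ) ≤ (K ^ 3) ^ (1 / 3 : ℝ) :=
        Real.rpow_le_rpow (by positivity) hy (by norm_num)
      have h2 : (K ^ 3) ^ (1 / 3 : ℝ) = K := by
        rw [hthird]; exact Real.pow_rpow_inv_natCast hK0 three_ne_zero
      have h3 : (a ^ 5) ^ (1 / 3 : ℝ) = a ^ (5 / 3 : ℝ) := by
        have : (a ^ 5 : ℝ) = a ^ (5 : ℝ) := by exact_mod_cast (Real.rpow_natCast a 5).symm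
        rw [this, ← Real.rpow_mul hapos.le]; norm_num
      rw [← h3, ← h2]; exact h1
    calc a ^ 2 = a ^ (2 : ℝ) := (Real.rpow_two a).symm
      _ = a ^ (5 / 3 : ℝ) * a ^ (1 / 3 : ℝ) := by rw [← Real.rpow_add hapos]; norm_num
      _ ≤ K * a ^ (1 / 3 : ℝ) := mul_le_mul_of_nonneg_right h53 (Real.rpow_nonneg hapos.le _)
  have hc3 : c ^ 3 = 256 / V := by
    rw [hc, hthird]; exact Real.rpow_inv_natCast_pow (by positivity) three_ne_zero
  have hE3 : (E ^ (1 / 3 : ℝ)) ^ 3 = E := by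
    rw [hthird]; exact Real.rpow_inv_natCast_pow hE.le three_ne_zero
  by_cases hbdd : BddAbove (Set.range fun y => ‖fderiv ℝ f y‖)
  · set G₀ := ⨆ y, ‖fderiv ℝ f y‖ with hG₀
    have hle : ∀ y, ‖fderiv ℝ f y‖ ≤ G₀ := fun y => le_ciSup hbdd y
    rcases lt_or_ge 0 G₀ with hGpos | hGle
    · -- bounded, non-trivial gradient: take `y` with ‖∇f(y)‖ > G₀/2
      obtain ⟨y, hy⟩ : ∃ y, G₀ / 2 < ‖fderiv ℝ f y‖ := exists_lt_of_lt_ciSup (by linarith)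
      refine ⟨y, ?_⟩
      have hcore := pow_five_le_of_fderiv_le hf hGpos hle hE.le hen x
      rw [hVdef] at hcore
      have hG2 : G₀ ≤ 2 * ‖fderiv ℝ f y‖ := by linarith
      have hprod : (c * E ^ (1 / 3 : ℝ) * ‖fderiv ℝ f y‖) ^ 3 =
          256 * E * ‖fderiv ℝ f y‖ ^ 3 / V := by
        rw [mul_pow, mul_pow, hc3, hE3]; ring
      rw [hprod, le_div_iff₀ hv]
      calc a ^ 5 * V ≤ 32 * E * G₀ ^ 3 := hcore
        _ ≤ 32 * E * (2 * ‖fderiv ℝ f y‖) ^ 3 := by gcongr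
        _ = 256 * E * ‖fderiv ℝ f y‖ ^ 3 := by ring
    · -- zero gradient: `f` is a non-zero constant of finite energy on ℝ³ — impossible
      exfalso
      set G := min 1 (V / (64 * E)) with hGdef
      have hGpos : 0 < G := lt_min one_pos (div_pos hv (by positivity))
      have hG1 : G ≤ 1 := min_le_left _ _
      have hG2 : G ≤ V / (64 * E) := min_le_right _ _
      have hcore := pow_five_le_of_fderiv_le hf hGpos
        (fun y => (hle y).trans (hGle.trans hGpos.le)) hE.le hen x
      rw [hVdef] at hcore
      have hG3 : G ^ 3 ≤ G := by
        calc G ^ 3 = G * (G * G) := by ring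
          _ ≤ G * (1 * 1) := by gcongr
          _ = G := by ring
      have h32 : 32 * E * G ≤ V / 2 := by
        calc 32 * E * G ≤ 32 * E * (V / (64 * E)) := by gcongr
          _ = V / 2 := by field_simp; ring
      nlinarith
  · -- unbounded gradient: any `y` with a large gradient works
    rw [not_bddAbove_iff] at hbdd
    have hcE : 0 < c * E ^ (1 / 3 : ℝ) := mul_pos hcpos (Real.rpow_pos_of_pos hE _)
    obtain ⟨_, ⟨y, rfl⟩, hy⟩ := hbdd (a ^ 5 / (c * E ^ (1 / 3 : ℝ)))
    refine ⟨y, ?_⟩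
    have hK : a ^ 5 ≤ c * E ^ (1 / 3 : ℝ) * ‖fderiv ℝ f y‖ := by
      have h' := (div_lt_iff₀ hcE).1 hy
      linarith
    calc a ^ 5 ≤ (a ^ 5) ^ 3 := le_self_pow₀ h5 three_ne_zero
      _ ≤ (c * E ^ (1 / 3 : ℝ) * ‖fderiv ℝ f y‖) ^ 3 := pow_le_pow_left₀ (by positivity) hK 3

end Summit.NavierStokesRegularity.NavierStokesRegularity.Theorems.RootDecompReynoldsHorizonFloor

end
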